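import Mathlib
import Summits.ValiantsHypothesis.ValiantsHypothesis.Theorems.BarrierLeverPartitionMinorsHitByVPHiddenStatesHubJoinsAxisGood

/-!
# Route BarrierLever — item `PartitionMinorsHitByVP` (stmt-ValiantsHypothesis-19717), line `hidden-states`,
# stub `stub_universalJoinWide` (the conjecture node, `K ≤ h³`): WIDE HUB JOINS — the node FOR ALL ROW FAMILIES
# up to `r = 2h⁴ + 4h³ + 4h² + 2h`, and for EVERY `r ≤ 2^h` at `h = 18`

Helper file (`--supports stmt-ValiantsHypothesis-19717`; cell valiant-natproofs, rung V4, 𝒟-side door (c); prover seat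
val-np-p6 gen 10, registered line `Cruxes/PartitionMinorsHitByVP/Lines/hidden_states.lean` v7). Definition-free; closes NO item.

THE POINT. val-np-p8 g3's axis-table theorem `HubAxis.hubJoin_good_of_balanced` is generic in the number of states `K`:
the hub-join family `HubJoin.hubE` (`m` pieces of `K` states: base, hub, `K−1` satellites, `l` married pairs; a legal STRICT
threshold join family, `HubJoin.hub_threshold`) has a nonsingular block-additive matrix for every injective row family `u`
with a coordinate `y` carrying at least `m(l+1)` members on each side. p8 instantiated it at `K = h·h` (`stub_qjoinSharp`).
Here it is instantiated at `K = h·h·h`, the budget of the conjecture node `Stmt.stub_universalJoinWide`: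

* `universalJoinWide_body_balanced` — ONE wide design (`2h` pieces, `h³` states, `l` married pairs each), good for every
  injective `u` with a balanced coordinate (`2h(l+1)` members on each side).
* `universalJoinWide_of_le_hub` — for `h ≥ 4` and EVERY `r ≤ 2h(h³+1) + 4h³ + 4h²` the body of the node holds FOR ALL
  injective `u` (star joins below `2h(h³+1)`, p578997; above, `l = (r − 2h(h³+1))/2h + 1` pairs per piece and a balanced
  coordinate from `HubAxis.exists_balanced_coord`). First statement of the node past the star range with no hypothesis on `u`.
* `card_filter_mem_le`, `card_filter_not_mem_le` — the TRIVIAL BALANCE: an injective family of subsets of `Fin (n+1)` has at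
  most `2^n` members containing (resp. avoiding) any coordinate; so for `r` well inside the upper half every coordinate is balanced.
* `universalJoinWide_of_upper` — if `2h(h³+1) < r ≤ 2h(h³+1+l)`, `l+1 ≤ h³` and `2h(l+1) + 2^{h−1} ≤ r`, the body holds for all `u`.
* **`universalJoinWide_eighteen`, `universalJoinWide_upto_eighteen`** — at `h = 18` the whole window `(209 988, 262 144]` left open
  by the star range satisfies the trivial-balance inequality (`2^17 = 131 072 ≤ 209 916`), so the body of `Stmt.stub_universalJoinWide`
  holds for EVERY `r ≤ 2^h` whenever `1 ≤ h ≤ 18`. The node's first open window moves from `h = 18` to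
  `h = 19, r ∈ (289 560, 524 288]` — where hub joins cannot suffice even in principle (capacity `2h·2h³ = 4h⁴ = 521 284 < 2^19`).

WHAT THIS IS NOT: `stub_universalJoinWide` (∃ h₁ ∀ h ≥ h₁ …) stays OPEN; partial ranges are helpers, not the stub; nothing on
crux 14610 or VP ≠ VNP.
-/

set_option linter.dupNamespace false

namespace Summit.ValiantsHypothesis.ValiantsHypothesis.Theorems.BarrierLever.HiddenStates

open Finset Matrix

noncomputable section

namespace HubWide

open HubJoin (hubE hubE_injective hub_threshold hubW hubWt)
open HubAxis (hubJoin_good_of_balanced exists_balanced_coord)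

/-! ## 1. The wide hub design (K = h³) is good for every row family with a balanced coordinate -/

/-- **Wide hub joins, balanced form.** For `l + 1 ≤ h³` and `r ≤ 2h(h³+1+l)` there is ONE legal wide join threshold design
(`2h` pieces, `h³` states) good for every injective `u` having a coordinate with `2h(l+1)` members on each side. -/
theorem universalJoinWide_body_balanced (h l r : ℕ) (hl : l + 1 ≤ h * h * h) (hr : r ≤ (h + h) * (h * h * h + 1 + l)) :
    ∃ (m K : ℕ) (W : Fin m → ℕ) (wt : Fin m → Fin K → ℕ) (e : Fin r → Fin m × Finset (Fin K)),
      m ≤ h + h ∧ K ≤ h * h * h ∧ Function.Injective e ∧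
      (∀ x : Fin m × Finset (Fin K), x ∉ Set.range e →
        ∀ i, W (e i).1 + ∑ k ∈ (e i).2, wt (e i).1 k < W x.1 + ∑ k ∈ x.2, wt x.1 k) ∧
      ∀ u : Fin r → Finset (Fin h), Function.Injective u →
        (∃ y : Fin h, (h + h) * (l + 1) ≤ (Finset.univ.filter fun i : Fin r => y ∉ u i).card ∧
          (h + h) * (l + 1) ≤ (Finset.univ.filter fun i : Fin r => y ∈ u i).card) →
        ∃ tx : Fin m → Option (Fin K) → Fin h → ℂ,
          (Matrix.of fun i k : Fin r =>
            ∏ a ∈ u i, (tx (e k).1 none a + ∑ q ∈ (e k).2, tx (e k).1 (some q) a)).det ≠ 0 := by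
  refine ⟨h + h, h * h * h, hubW (h * h * h) l r, hubWt (h * h * h) l r, hubE hl hr, le_rfl, le_rfl,
    hubE_injective hl hr, hub_threshold hl hr, ?_⟩
  rintro u hu ⟨y, hy₀, hy₁⟩
  exact hubJoin_good_of_balanced hl hr u hu y hy₀ hy₁

/-! ## 2. The node for all row families up to `2h⁴ + 4h³ + 4h² + 2h` -/

/-- **The conjecture node FOR ALL ROW FAMILIES up to `2h(h³+1) + 4h³ + 4h²`.** For `h ≥ 4` and every such `r` the body of
`Stmt.stub_universalJoinWide` holds at `(h, r)`: ONE legal wide join threshold design (`≤ 2h` pieces, `≤ h³` states) is good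
for EVERY injective `u : Fin r → Finset (Fin h)`. -/
theorem universalJoinWide_of_le_hub (h r : ℕ) (hh : 4 ≤ h)
    (hr : r ≤ (h + h) * (h * h * h + 1) + 4 * (h * h * h) + 4 * (h * h)) :
    ∃ (m K : ℕ) (W : Fin m → ℕ) (wt : Fin m → Fin K → ℕ) (e : Fin r → Fin m × Finset (Fin K)),
      m ≤ h + h ∧ K ≤ h * h * h ∧ Function.Injective e ∧
      (∀ x : Fin m × Finset (Fin K), x ∉ Set.range e →
        ∀ i, W (e i).1 + ∑ k ∈ (e i).2, wt (e i).1 k < W x.1 + ∑ k ∈ x.2, wt x.1 k) ∧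
      ∀ u : Fin r → Finset (Fin h), Function.Injective u →
        ∃ tx : Fin m → Option (Fin K) → Fin h → ℂ,
          (Matrix.of fun i k : Fin r =>
            ∏ a ∈ u i, (tx (e k).1 none a + ∑ q ∈ (e k).2, tx (e k).1 (some q) a)).det ≠ 0 := by
  by_cases hsmall : r ≤ (h + h) * (h * h * h + 1)
  · exact StarJoin.universalJoinWide_of_le h r hsmall
  push Not at hsmall
  -- the excess over the star range and the number of married pairs per piece
  set L := r - (h + h) * (h * h * h + 1) with hL
  have hLr : r = (h + h) * (h * h * h + 1) + L := by omega
  have hLle : L ≤ 4 * (h * h * h) + 4 * (h * h) := by omega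
  have hh0 : 0 < h + h := by omega
  set l := L / (h + h) + 1 with hl'
  have hdiv : L / (h + h) ≤ 2 * (h * h) + 2 * h := by
    apply Nat.div_le_of_le_mul
    nlinarith
  have hcube : 4 * (h * h) ≤ h * h * h := by nlinarith
  have hl : l + 1 ≤ h * h * h := by nlinarith
  have hLl : L ≤ (h + h) * l := by
    have := Nat.div_add_mod L (h + h)
    have hmod := Nat.mod_lt L hh0
    nlinarith
  have hr' : r ≤ (h + h) * (h * h * h + 1 + l) := by nlinarith
  obtain ⟨m, K, W, wt, e, hm, hK, he, hthr, hgood⟩ := universalJoinWide_body_balanced h l r hl hr'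
  refine ⟨m, K, W, wt, e, hm, hK, he, hthr, fun u hu => hgood u hu ?_⟩
  -- a balanced coordinate with 2h(l+1) members on each side
  have hcount : h * ((h + h) * (l + 1)) + h + 2 < 2 * r := by
    have hml : (h + h) * (L / (h + h)) ≤ L := Nat.mul_div_le L (h + h)
    obtain ⟨h', rfl⟩ : ∃ h', h = h' + 4 := ⟨h - 4, by omega⟩
    nlinarith
  exact exists_balanced_coord u hu _ hcount

/-! ## 3. The trivial balance and the upper range -/

/-- An injective family of subsets of `Fin h` has at most `2^(h-1)` members containing a given coordinate. -/
theorem card_filter_mem_le {h r : ℕ} (u : Fin r → Finset (Fin h)) (hu : Function.Injective u) (y : Fin h) :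
    (Finset.univ.filter fun i : Fin r => y ∈ u i).card ≤ 2 ^ (h - 1) := by
  classical
  have hinj : Set.InjOn (fun i : Fin r => (u i).erase y) ↑(Finset.univ.filter fun i : Fin r => y ∈ u i) := by
    intro i hi j hj hij
    simp only [Finset.coe_filter, Finset.mem_univ, true_and, Set.mem_setOf_eq] at hi hj
    apply hu
    have := congrArg (insert y) hij
    simp only [Finset.insert_erase hi, Finset.insert_erase hj] at this
    exact this
  have hmaps : ∀ i ∈ (Finset.univ.filter fun i : Fin r => y ∈ u i), (u i).erase y ∈ (Finset.univ.erase y).powerset := by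
    intro i _
    rw [Finset.mem_powerset]
    exact Finset.erase_subset_erase y (Finset.subset_univ _)
  calc (Finset.univ.filter fun i : Fin r => y ∈ u i).card
      ≤ ((Finset.univ : Finset (Fin h)).erase y).powerset.card := Finset.card_le_card_of_injOn _ hmaps hinj
    _ = 2 ^ (h - 1) := by
        rw [Finset.card_powerset, Finset.card_erase_of_mem (Finset.mem_univ y), Finset.card_univ, Fintype.card_fin]

/-- An injective family of subsets of `Fin h` has at most `2^(h-1)` members avoiding a given coordinate. -/
theorem card_filter_not_mem_le {h r : ℕ} (u : Fin r → Finset (Fin h)) (hu : Function.Injective u) (y : Fin h) :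
    (Finset.univ.filter fun i : Fin r => y ∉ u i).card ≤ 2 ^ (h - 1) := by
  classical
  have hinj : Set.InjOn (fun i : Fin r => u i) ↑(Finset.univ.filter fun i : Fin r => y ∉ u i) :=
    fun i _ j _ hij => hu hij
  have hmaps : ∀ i ∈ (Finset.univ.filter fun i : Fin r => y ∉ u i), u i ∈ (Finset.univ.erase y).powerset := by
    intro i hi
    simp only [Finset.mem_filter, Finset.mem_univ, true_and] at hi
    rw [Finset.mem_powerset]
    intro a ha
    rw [Finset.mem_erase]
    exact ⟨fun h' => hi (h' ▸ ha), Finset.mem_univ a⟩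
  calc (Finset.univ.filter fun i : Fin r => y ∉ u i).card
      ≤ ((Finset.univ : Finset (Fin h)).erase y).powerset.card := Finset.card_le_card_of_injOn _ hmaps hinj
    _ = 2 ^ (h - 1) := by
        rw [Finset.card_powerset, Finset.card_erase_of_mem (Finset.mem_univ y), Finset.card_univ, Fintype.card_fin]

/-- The two sides of a coordinate partition the family. -/
theorem card_filter_mem_add {h r : ℕ} (u : Fin r → Finset (Fin h)) (y : Fin h) :
    (Finset.univ.filter fun i : Fin r => y ∈ u i).card + (Finset.univ.filter fun i : Fin r => y ∉ u i).card = r := by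
  classical
  have := Finset.card_filter_add_card_filter_not (s := (Finset.univ : Finset (Fin r))) (fun i : Fin r => y ∈ u i)
  simpa using this

/-- **The node on the upper range by trivial balance.** If `l + 1 ≤ h³`, `r ≤ 2h(h³+1+l)` and `2h(l+1) + 2^{h−1} ≤ r`
(with `h ≥ 1`), the body of `Stmt.stub_universalJoinWide` holds at `(h, r)` for ALL injective `u`: every coordinate is balanced. -/
theorem universalJoinWide_of_upper (h l r : ℕ) (h1 : 1 ≤ h) (hl : l + 1 ≤ h * h * h)
    (hr : r ≤ (h + h) * (h * h * h + 1 + l)) (hbal : (h + h) * (l + 1) + 2 ^ (h - 1) ≤ r) :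
    ∃ (m K : ℕ) (W : Fin m → ℕ) (wt : Fin m → Fin K → ℕ) (e : Fin r → Fin m × Finset (Fin K)),
      m ≤ h + h ∧ K ≤ h * h * h ∧ Function.Injective e ∧
      (∀ x : Fin m × Finset (Fin K), x ∉ Set.range e →
        ∀ i, W (e i).1 + ∑ k ∈ (e i).2, wt (e i).1 k < W x.1 + ∑ k ∈ x.2, wt x.1 k) ∧
      ∀ u : Fin r → Finset (Fin h), Function.Injective u →
        ∃ tx : Fin m → Option (Fin K) → Fin h → ℂ,
          (Matrix.of fun i k : Fin r =>
            ∏ a ∈ u i, (tx (e k).1 none a + ∑ q ∈ (e k).2, tx (e k).1 (some q) a)).det ≠ 0 := by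
  obtain ⟨m, K, W, wt, e, hm, hK, he, hthr, hgood⟩ := universalJoinWide_body_balanced h l r hl hr
  refine ⟨m, K, W, wt, e, hm, hK, he, hthr, fun u hu => hgood u hu ?_⟩
  have y : Fin h := ⟨0, h1⟩
  refine ⟨y, ?_, ?_⟩
  · have h1' := card_filter_mem_le u hu y
    have h2' := card_filter_mem_add u y
    omega
  · have h1' := card_filter_not_mem_le u hu y
    have h2' := card_filter_mem_add u y
    omega

/-! ## 4. `h = 18`: the whole window `(2h⁴+2h, 2^h]` falls to trivial balance -/

/-- **The conjecture node at `h = 18` for EVERY `r ≤ 2^18`.** (Star range up to `209 988`; above it, hub joins with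
`l = ⌈(r − 209 988)/36⌉` married pairs per piece; balance `36(l+1) ≤ r − 209 916 ≤ r − 2^17`.) -/
theorem universalJoinWide_eighteen (r : ℕ) (hr : r ≤ 2 ^ 18) :
    ∃ (m K : ℕ) (W : Fin m → ℕ) (wt : Fin m → Fin K → ℕ) (e : Fin r → Fin m × Finset (Fin K)),
      m ≤ 18 + 18 ∧ K ≤ 18 * 18 * 18 ∧ Function.Injective e ∧
      (∀ x : Fin m × Finset (Fin K), x ∉ Set.range e →
        ∀ i, W (e i).1 + ∑ k ∈ (e i).2, wt (e i).1 k < W x.1 + ∑ k ∈ x.2, wt x.1 k) ∧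
      ∀ u : Fin r → Finset (Fin 18), Function.Injective u →
        ∃ tx : Fin m → Option (Fin K) → Fin 18 → ℂ,
          (Matrix.of fun i k : Fin r =>
            ∏ a ∈ u i, (tx (e k).1 none a + ∑ q ∈ (e k).2, tx (e k).1 (some q) a)).det ≠ 0 := by
  by_cases hsmall : r ≤ (18 + 18) * (18 * 18 * 18 + 1)
  · exact StarJoin.universalJoinWide_of_le 18 r hsmall
  push Not at hsmall
  have hr' : r ≤ 262144 := by norm_num at hr; exact hr
  set l := (r - (18 + 18) * (18 * 18 * 18 + 1) + 35) / 36 with hl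
  refine universalJoinWide_of_upper 18 l r (by norm_num) ?_ ?_ ?_
  · omega
  · omega
  · norm_num
    omega

/-- `2 ≤ 2h⁴` bookkeeping: for `1 ≤ h ≤ 17` the star range already covers `2^h` (p578997). At `h = 18` it does not
(`209 988 < 262 144`), and `universalJoinWide_eighteen` closes the gap. -/
theorem universalJoinWide_upto_eighteen (h : ℕ) (h1 : 1 ≤ h) (h18 : h ≤ 18) (r : ℕ) (hr : r ≤ 2 ^ h) :
    ∃ (m K : ℕ) (W : Fin m → ℕ) (wt : Fin m → Fin K → ℕ) (e : Fin r → Fin m × Finset (Fin K)),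
      m ≤ h + h ∧ K ≤ h * h * h ∧ Function.Injective e ∧
      (∀ x : Fin m × Finset (Fin K), x ∉ Set.range e →
        ∀ i, W (e i).1 + ∑ k ∈ (e i).2, wt (e i).1 k < W x.1 + ∑ k ∈ x.2, wt x.1 k) ∧
      ∀ u : Fin r → Finset (Fin h), Function.Injective u →
        ∃ tx : Fin m → Option (Fin K) → Fin h → ℂ,
          (Matrix.of fun i k : Fin r =>
            ∏ a ∈ u i, (tx (e k).1 none a + ∑ q ∈ (e k).2, tx (e k).1 (some q) a)).det ≠ 0 := by
  by_cases h17 : h ≤ 17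
  · exact StarJoin.universalJoinWide_upto_seventeen h h1 h17 r hr
  · obtain rfl : h = 18 := by omega
    exact universalJoinWide_eighteen r hr

/-- `2^19` exceeds the capacity `2h · 2h³ = 4h⁴` of every hub-join design at `h = 19` (`521 284 < 524 288`): the method of this
file cannot close `h = 19`; the first open window of the node is `h = 19`, `r ∈ (2h(h³+1)+4h³+4h², 2^h] = (289 560, 524 288]`. -/
theorem hub_capacity_lt_two_pow_nineteen : (19 + 19) * (19 * 19 * 19 + 19 * 19 * 19) < 2 ^ 19 := by norm_num

/-- The numerical lower end of the first open window at `h = 19`. -/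
theorem hub_range_nineteen : (19 + 19) * (19 * 19 * 19 + 1) + 4 * (19 * 19 * 19) + 4 * (19 * 19) = 289560 := by norm_num

end HubWide

end

end Summit.ValiantsHypothesis.ValiantsHypothesis.Theorems.BarrierLever.HiddenStates
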